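import Literature.Analysis.FunctionSpaces.TorusAnalyticSeminorm
import Mathlib.LinearAlgebra.Matrix.Adjugate
import Mathlib.Data.Nat.Choose.Sum
import HarnessLib

/-!
# K1L_D (stmt-AnomalousDissipation-27980), (ℓ3-A) road A `…FrameInstanceRegularity`: GRADED LEIBNIZ BOUNDS — products and `3 × 3` adjugates
# inherit derivative bounds of the shape `θ·Lⁿ` (helper, `--supports 27980 --as helper`; prover lead-k1l-onelevel-p1 g8; RULING D28-25 (2b))

Pure torus calculus over `Torus.iterPartialDeriv` / `Torus.derivSup` (no definitions, no named facts).  If smooth real functions `φ, ψ` on `T^d`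
obey `derivSup 0 φ ≤ A₁`, `derivSup n φ ≤ B₁ θ Lⁿ` (`1 ≤ n ≤ K`) and the same for `ψ` with `(A₂, B₂)`, `0 ≤ θ ≤ 1`, then the product obeys
`derivSup 0 (φψ) ≤ A₁A₂`, `derivSup n (φψ) ≤ 2^K (B₁(A₂+B₂) + A₁B₂) θ Lⁿ` (binomial Leibniz bound `Torus.derivSup_mul_le_sum`, every term carries
at least one factor `θ`): `derivSup_mul_graded`.  Consequence for a smooth matrix field `J : T³ → M₃(ℝ)` with `|J_{pr}| ≤ 2` and
`|∂^l J_{pr}| ≤ B θ L^{|l|}` (`1 ≤ |l| ≤ K`): every adjugate entry obeys `|∂^l adj(J)_{il}| ≤ K_adj(B,K) θ L^{|l|}` with the explicit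
`K_adj = 6 · 2^K ((2^K B(4+B))(2+B) + 4B)` (Leibniz formula for `det (J.updateRow l eᵢ)`, a signed sum of six triple products):
`abs_iterPartialDeriv_adjugate_le`.  This is the `G = adj J` half of `IsFrameRegular.derivBound` / `IsFrameRegular6` for the clamped
exact-flow frame.  NOT a proof of K1L_D or of AD; rung F-D1.A0.
-/

set_option linter.dupNamespace false

noncomputable section

namespace Summit.AnomalousDissipation.AnomalousDissipation.Theorems.SolenoidalFractalHomogenisation.LagrangianStep.FrameInst

open Set Function Finset
open Literature.Analysis Literature.Analysis.FunctionSpaces Literature.Analysis.FunctionSpaces.Torus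

section General

variable {d : Type*} [Fintype d] [DecidableEq d]

omit [Fintype d] in
/-- From pointwise bounds on all words of length `n` to `derivSup n`. [cite: ArmstrongVicol2025, App. A (A.1)] -/
theorem derivSup_le_of_abs_le {φ : UnitAddTorus d → ℝ} {n : ℕ} {C : ℝ} (hC : 0 ≤ C)
    (h : ∀ l : List d, l.length = n → ∀ y, |iterPartialDeriv l φ y| ≤ C) : derivSup n φ ≤ C :=
  derivSup_le hC fun l hl y => by rw [Real.norm_eq_abs]; exact h l hl y

/-- **Graded Leibniz bound for products.**  If `derivSup 0 φ ≤ A₁`, `derivSup n φ ≤ B₁ θ Lⁿ` (`1 ≤ n ≤ K`) and the same for `ψ` with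
`(A₂, B₂)`, `0 ≤ θ ≤ 1`, then `derivSup 0 (φψ) ≤ A₁A₂` and `derivSup n (φψ) ≤ 2^K (B₁(A₂+B₂) + A₁B₂) θ Lⁿ` for `1 ≤ n ≤ K`
(each term `C(n,k)·derivSup k φ·derivSup (n−k) ψ` of the binomial Leibniz bound carries at least one factor `θ`; `Σ_k C(n,k) = 2ⁿ ≤ 2^K`). -/
theorem derivSup_mul_graded {φ ψ : UnitAddTorus d → ℝ} (hφ : IsSmooth φ) (hψ : IsSmooth ψ) {A₁ B₁ A₂ B₂ θ L : ℝ}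
    (hA₁ : 0 ≤ A₁) (hB₁ : 0 ≤ B₁) (hA₂ : 0 ≤ A₂) (hB₂ : 0 ≤ B₂) (hθ0 : 0 ≤ θ) (hθ1 : θ ≤ 1) (hL : 0 ≤ L) {K : ℕ}
    (hφ0 : derivSup 0 φ ≤ A₁) (hφn : ∀ n, 1 ≤ n → n ≤ K → derivSup n φ ≤ B₁ * θ * L ^ n)
    (hψ0 : derivSup 0 ψ ≤ A₂) (hψn : ∀ n, 1 ≤ n → n ≤ K → derivSup n ψ ≤ B₂ * θ * L ^ n) :
    derivSup 0 (fun y => φ y * ψ y) ≤ A₁ * A₂ ∧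
      ∀ n, 1 ≤ n → n ≤ K → derivSup n (fun y => φ y * ψ y) ≤ 2 ^ K * (B₁ * (A₂ + B₂) + A₁ * B₂) * θ * L ^ n := by
  refine ⟨?_, fun n hn1 hnK => ?_⟩
  · have h := derivSup_mul_le_sum 0 hφ hψ
    simp only [zero_add, Finset.sum_range_one, Nat.choose_self, Nat.cast_one, one_mul, Nat.sub_zero] at h
    exact h.trans (mul_le_mul hφ0 hψ0 (derivSup_nonneg _ _) hA₁)
  · set M : ℝ := B₁ * (A₂ + B₂) + A₁ * B₂ with hM
    have hM0 : 0 ≤ M := by rw [hM]; positivity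
    -- every term of the Leibniz sum is at most `C(n,k) · M θ Lⁿ`
    have hterm : ∀ k ∈ Finset.range (n + 1),
        (n.choose k : ℝ) * (derivSup k φ * derivSup (n - k) ψ) ≤ (n.choose k : ℝ) * (M * θ * L ^ n) := by
      intro k hk
      have hkn : k ≤ n := Nat.lt_succ_iff.mp (Finset.mem_range.mp hk)
      refine mul_le_mul_of_nonneg_left ?_ (Nat.cast_nonneg _)
      rcases Nat.eq_zero_or_pos k with rfl | hk1
      · -- `k = 0`: `A₁ · B₂ θ Lⁿ`
        rw [Nat.sub_zero]
        calc derivSup 0 φ * derivSup n ψ ≤ A₁ * (B₂ * θ * L ^ n) :=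
              mul_le_mul hφ0 (hψn n hn1 hnK) (derivSup_nonneg _ _) hA₁
          _ ≤ M * θ * L ^ n := by
              rw [hM]
              nlinarith [mul_nonneg (mul_nonneg (mul_nonneg hB₁ (add_nonneg hA₂ hB₂)) hθ0) (pow_nonneg hL n)]
      · -- `k ≥ 1`: `B₁ θ L^k · (A₂ + B₂) L^{n-k}`
        have h1 : derivSup k φ ≤ B₁ * θ * L ^ k := hφn k hk1 (hkn.trans hnK)
        have h2 : derivSup (n - k) ψ ≤ (A₂ + B₂) * L ^ (n - k) := by
          rcases Nat.eq_zero_or_pos (n - k) with h0 | hpos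
          · rw [h0, pow_zero, mul_one]; linarith [hψ0]
          · calc derivSup (n - k) ψ ≤ B₂ * θ * L ^ (n - k) := hψn (n - k) hpos (by omega)
              _ ≤ B₂ * 1 * L ^ (n - k) := by
                  refine mul_le_mul_of_nonneg_right (mul_le_mul_of_nonneg_left hθ1 hB₂) (pow_nonneg hL _)
              _ ≤ (A₂ + B₂) * L ^ (n - k) := by
                  rw [mul_one]; exact mul_le_mul_of_nonneg_right (by linarith) (pow_nonneg hL _)
        have hpow : L ^ k * L ^ (n - k) = L ^ n := by rw [← pow_add, Nat.add_sub_cancel' hkn]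
        calc derivSup k φ * derivSup (n - k) ψ ≤ (B₁ * θ * L ^ k) * ((A₂ + B₂) * L ^ (n - k)) :=
              mul_le_mul h1 h2 (derivSup_nonneg _ _) (by positivity)
          _ = B₁ * (A₂ + B₂) * θ * (L ^ k * L ^ (n - k)) := by ring
          _ ≤ M * θ * L ^ n := by
              rw [hpow, hM]
              nlinarith [mul_nonneg (mul_nonneg (mul_nonneg hA₁ hB₂) hθ0) (pow_nonneg hL n)]
    have hsum : ∑ k ∈ Finset.range (n + 1), (n.choose k : ℝ) * (M * θ * L ^ n) = 2 ^ n * (M * θ * L ^ n) := by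
      rw [← Finset.sum_mul]
      congr 1
      have h := Nat.sum_range_choose n
      have : (∑ k ∈ Finset.range (n + 1), (n.choose k : ℝ)) = ((∑ k ∈ Finset.range (n + 1), n.choose k : ℕ) : ℝ) := by
        push_cast; rfl
      rw [this, h]; push_cast; rfl
    have h2n : (2 : ℝ) ^ n ≤ 2 ^ K := pow_le_pow_right₀ (by norm_num) hnK
    calc derivSup n (fun y => φ y * ψ y)
        ≤ ∑ k ∈ Finset.range (n + 1), (n.choose k : ℝ) * (derivSup k φ * derivSup (n - k) ψ) := derivSup_mul_le_sum n hφ hψ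
      _ ≤ ∑ k ∈ Finset.range (n + 1), (n.choose k : ℝ) * (M * θ * L ^ n) := Finset.sum_le_sum hterm
      _ = 2 ^ n * (M * θ * L ^ n) := hsum
      _ ≤ 2 ^ K * (M * θ * L ^ n) := mul_le_mul_of_nonneg_right h2n (by positivity)
      _ = 2 ^ K * M * θ * L ^ n := by ring

end General

/-! ## The `3 × 3` adjugate -/

/-- **Adjugate entries inherit graded derivative bounds.**  For a smooth matrix field `J : T³ → M₃(ℝ)` with `|J_{pr}(y)| ≤ 2` and
`|∂^l J_{pr}(y)| ≤ B θ L^{|l|}` for all words `1 ≤ |l| ≤ K` (`0 ≤ θ ≤ 1`, `B, L ≥ 0`), every adjugate entry satisfies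
`|∂^l adj(J(y))_{il}| ≤ 6 · 2^K ((2^K B(4+B))(2+B) + 4B) · θ L^{|l|}` for `1 ≤ |l| ≤ K` (Leibniz formula: `adj(J)_{il} = det(J.updateRow l eᵢ)`
is a signed sum of six triple products of entries of `J` and the constants `0, 1`; two applications of `derivSup_mul_graded`). -/
theorem abs_iterPartialDeriv_adjugate_le {J : UnitAddTorus (Fin 3) → Matrix (Fin 3) (Fin 3) ℝ}
    (hJs : ∀ p r, IsSmooth (fun y => J y p r)) {B θ L : ℝ} (hB : 0 ≤ B) (hθ0 : 0 ≤ θ) (hθ1 : θ ≤ 1) (hL : 0 ≤ L) {K : ℕ}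
    (h0 : ∀ p r y, |J y p r| ≤ 2)
    (hn : ∀ p r (l : List (Fin 3)), 1 ≤ l.length → l.length ≤ K → ∀ y, |iterPartialDeriv l (fun y => J y p r) y| ≤ B * θ * L ^ l.length)
    (i l₀ : Fin 3) (l : List (Fin 3)) (h1 : 1 ≤ l.length) (hK : l.length ≤ K) (y : UnitAddTorus (Fin 3)) :
    |iterPartialDeriv l (fun y => (J y).adjugate i l₀) y| ≤
      6 * (2 ^ K * ((2 ^ K * (B * (4 + B))) * (2 + B) + 4 * B)) * θ * L ^ l.length := by
  classical
  -- the factors of the Leibniz formula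
  set F : Equiv.Perm (Fin 3) → Fin 3 → UnitAddTorus (Fin 3) → ℝ :=
    fun σ r y => (J y).updateRow l₀ (Pi.single i 1) (σ r) r with hF
  have hFcase : ∀ σ r, (F σ r = fun y => J y (σ r) r) ∨ ∃ c : ℝ, |c| ≤ 1 ∧ F σ r = fun _ => c := by
    intro σ r
    by_cases h : σ r = l₀
    · refine Or.inr ⟨(Pi.single i (1:ℝ) : Fin 3 → ℝ) r, ?_, ?_⟩
      · rw [Pi.single_apply]; split_ifs <;> simp
      · funext y; simp only [hF, h, Matrix.updateRow_self]
    · left; funext y; simp only [hF, Matrix.updateRow_ne h]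
  -- each factor is smooth with graded bounds `(2, B)`
  have hFs : ∀ σ r, IsSmooth (F σ r) := by
    intro σ r
    rcases hFcase σ r with h | ⟨c, _, h⟩
    · rw [h]; exact hJs _ _
    · rw [h]; exact isSmooth_const c
  have hF0 : ∀ σ r, derivSup 0 (F σ r) ≤ 2 := by
    intro σ r
    refine derivSup_le_of_abs_le (by norm_num) fun l hl y => ?_
    obtain rfl : l = [] := List.eq_nil_of_length_eq_zero hl
    rw [iterPartialDeriv_nil]
    rcases hFcase σ r with h | ⟨c, hc, h⟩
    · rw [h]; exact h0 _ _ y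
    · rw [h]; linarith
  have hFn : ∀ σ r n, 1 ≤ n → n ≤ K → derivSup n (F σ r) ≤ B * θ * L ^ n := by
    intro σ r n hn1 hnK
    refine derivSup_le_of_abs_le (by positivity) fun l hl y => ?_
    rcases hFcase σ r with h | ⟨c, _, h⟩
    · rw [h, ← hl]; exact hn _ _ l (hl ▸ hn1) (hl ▸ hnK) y
    · have hlne : l ≠ [] := by intro e; subst e; simp at hl; omega
      rw [h, iterPartialDeriv_const c l hlne, Pi.zero_apply, abs_zero]; positivity
  -- triple products
  set B₂ : ℝ := 2 ^ K * (B * (2 + B) + 2 * B) with hB₂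
  have hB₂' : B₂ = 2 ^ K * (B * (4 + B)) := by rw [hB₂]; ring
  have hB₂0 : 0 ≤ B₂ := by rw [hB₂]; positivity
  set B₃ : ℝ := 2 ^ K * (B₂ * (2 + B) + 4 * B) with hB₃
  have hB₃0 : 0 ≤ B₃ := by rw [hB₃]; positivity
  have hP : ∀ σ n, 1 ≤ n → n ≤ K → derivSup n (fun y => ∏ r, F σ r y) ≤ B₃ * θ * L ^ n := by
    intro σ n hn1 hnK
    have e : (fun y => ∏ r, F σ r y) = fun y => (F σ 0 y * F σ 1 y) * F σ 2 y := by
      funext y; rw [Fin.prod_univ_three]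
    rw [e]
    have h01 := derivSup_mul_graded (hFs σ 0) (hFs σ 1) (by norm_num : (0:ℝ) ≤ 2) hB (by norm_num : (0:ℝ) ≤ 2) hB hθ0 hθ1 hL
      (K := K) (hF0 σ 0) (hFn σ 0) (hF0 σ 1) (hFn σ 1)
    have hs01 : IsSmooth (fun y => F σ 0 y * F σ 1 y) := (hFs σ 0).mul (hFs σ 1)
    have h012 := derivSup_mul_graded hs01 (hFs σ 2) (by norm_num : (0:ℝ) ≤ 2 * 2) hB₂0
      (by norm_num : (0:ℝ) ≤ 2) hB hθ0 hθ1 hL (K := K) h01.1 (fun n' h1' hK' => by rw [hB₂]; exact h01.2 n' h1' hK') (hF0 σ 2) (hFn σ 2)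
    have h := h012.2 n hn1 hnK
    have e3 : 2 ^ K * (B₂ * (2 + B) + 2 * 2 * B) = B₃ := by rw [hB₃]; ring
    rw [e3] at h
    exact h
  -- the Leibniz formula as a function of the label
  have hdet : (fun y => (J y).adjugate i l₀) = fun y => ∑ σ : Equiv.Perm (Fin 3), ((Equiv.Perm.sign σ : ℤ) : ℝ) • ∏ r, F σ r y := by
    funext y
    rw [Matrix.adjugate_apply, Matrix.det_apply]
    refine Finset.sum_congr rfl fun σ _ => ?_
    rw [Units.smul_def, ← Int.cast_smul_eq_zsmul ℝ]
  have hPs : ∀ σ, IsSmooth (fun y => ∏ r, F σ r y) := by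
    intro σ
    have e : (fun y => ∏ r, F σ r y) = fun y => (F σ 0 y * F σ 1 y) * F σ 2 y := by
      funext y; rw [Fin.prod_univ_three]
    rw [e]
    have hs01 : IsSmooth (fun y => F σ 0 y * F σ 1 y) := (hFs σ 0).mul (hFs σ 1)
    exact hs01.mul (hFs σ 2)
  have hsmul : ∀ σ : Equiv.Perm (Fin 3), IsSmooth (fun y => ((Equiv.Perm.sign σ : ℤ) : ℝ) • ∏ r, F σ r y) :=
    fun σ => (hPs σ).smul _
  rw [hdet, iterPartialDeriv_finset_sum _ (fun σ _ => hsmul σ) l]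
  have hcard : (Finset.univ : Finset (Equiv.Perm (Fin 3))).card = 6 := by
    rw [Finset.card_univ, Fintype.card_perm, Fintype.card_fin]; rfl
  calc |∑ σ : Equiv.Perm (Fin 3), iterPartialDeriv l (fun y => ((Equiv.Perm.sign σ : ℤ) : ℝ) • ∏ r, F σ r y) y|
      ≤ ∑ σ : Equiv.Perm (Fin 3), |iterPartialDeriv l (fun y => ((Equiv.Perm.sign σ : ℤ) : ℝ) • ∏ r, F σ r y) y| :=
        Finset.abs_sum_le_sum_abs _ _
    _ ≤ ∑ _σ : Equiv.Perm (Fin 3), B₃ * θ * L ^ l.length := Finset.sum_le_sum fun σ _ => by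
        rw [iterPartialDeriv_const_smul (hPs σ) _ l]
        simp only [smul_eq_mul, abs_mul]
        have hs : |(((Equiv.Perm.sign σ : ℤˣ) : ℤ) : ℝ)| = 1 := by
          rcases Int.units_eq_one_or (Equiv.Perm.sign σ) with h | h <;> simp [h]
        rw [hs, one_mul]
        have h := norm_iterPartialDeriv_le_derivSup (hPs σ) l y
        rw [Real.norm_eq_abs] at h
        exact h.trans (hP σ l.length h1 hK)
    _ = 6 * B₃ * θ * L ^ l.length := by rw [Finset.sum_const, hcard, nsmul_eq_mul]; push_cast; ring
    _ = 6 * (2 ^ K * ((2 ^ K * (B * (4 + B))) * (2 + B) + 4 * B)) * θ * L ^ l.length := by rw [hB₃, hB₂']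

end Summit.AnomalousDissipation.AnomalousDissipation.Theorems.SolenoidalFractalHomogenisation.LagrangianStep.FrameInst

end
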